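import Mathlib
import HarnessLib
import Summits.HubbardSuperconductivity.HubbardSuperconductivity.Theorems.KLProgrammeKLRegimeVolumeLimitTwoPointHamiltonianLimit
import Summits.HubbardSuperconductivity.HubbardSuperconductivity.Theorems.KLProgrammeKLRegimeVolumeLimitTwoPointClosure
import Summits.HubbardSuperconductivity.HubbardSuperconductivity.Theorems.KLProgrammeKLRegimeVolumeLimitBoundGlueTwoPoint
import Summits.HubbardSuperconductivity.HubbardSuperconductivity.Theorems.KLProgrammeKLRegimeVolumeLimitBoundGlueDominated
import Summits.HubbardSuperconductivity.HubbardSuperconductivity.Theorems.KLProgrammeKLRegimeVolumeLimitDoorsV14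

/-!
# The BARE-FRAME uniform bound of the VL carrier from (H1) — door-independent form, and the gen-5 (`klPredsV14`) closure
# (seat hubbard-kl-k3c5-p2, g3, «analytic-continuation-free assembly via FinalTwoLegVolLimit»)

Route `KLProgramme`, child VOLUME-LIMIT (gen 4: stmt-HubbardSuperconductivity-19858 on `klPredsV12`; gen 5: the re-based «cauchy» skeleton on
`klPredsV14`, k3c4-p1's `…VolumeLimitDoorsV14`).  `…TwoPointHamiltonianBound` / `…TwoPointClosure` close the gen-4 text of `stub_vl_bound` from
(H1) through k3c5-p3's V12 door.  The bundle-INDEPENDENT content is the bare-frame, spin-`↑` uniform bound beyond the prover's own thresholds: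

* **`bareFrameBound_of_H1`** — (H1) at every `L ≥ 3` ⟹ `∀ β > 0, ∀ U μ, ∃ B₀ L₀ Mth, ∀ L ≥ L₀, ∀ M ≥ Mth L, ∀ k,
  ‖klSelfEnergy L M β U μ 0 klE0 (nScales β + 1) k 0‖ ≤ B₀` with `B₀ = BH(β,U) + 1`, `L₀ = 3` (per volume: (Z1) = k3c5-p3's
  `sixPoint_pointwise_and_bound` + `l1_tendsto_of_pointwise_dominated`; `h2` = `klSelfEnergy_bare_label_limit_eq_reamputated` with the Hamiltonian
  proxy bounded by `norm_reamputatedProxy_le`; glue `eventually_norm_klSelfEnergy_bare_le_of_Z1_twoPoint`; thresholds packed by `exists_thresholdFn`);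
* **`stub_vl_bound_V14_of_H1`**, **`stub_vl_bound_V14_of_hasSumH1`** — the gen-5 registered text (`klPredsV14.frameOK`, `TowerP klPredsV14`)
  verbatim from (H1) in `Tendsto` resp. `HasSum` form, via `stub_vl_bound_of_bareFrameBound_V14`.

Everything is proved; no definition; every coupling.
-/

noncomputable section

namespace Summit.HubbardSuperconductivity.HubbardSuperconductivity.Theorems.TwoPointAssembly

set_option linter.dupNamespace false -- summit = problem name (single-conjunct summit), D-0017

open Finset Filter Topology MeasureTheory intervalIntegral Complex Literature.MathematicalPhysics.QuantumLattice Literature.Probability.LatticeModels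
  GrassmannAlgebra
open Summit.HubbardSuperconductivity.HubbardSuperconductivity.Theorems.ThermalGreen
open Summit.HubbardSuperconductivity.HubbardSuperconductivity.Theorems.MatsubaraAllU
open Summit.HubbardSuperconductivity.HubbardSuperconductivity.Theorems.KLRegimeSplit
open Summit.HubbardSuperconductivity.HubbardSuperconductivity.Theorems.KLProgrammeLegKernels
open scoped ComplexConjugate ComplexOrder Matrix.Norms.L2Operator Nat

/-- **THE BARE-FRAME UNIFORM BOUND FROM (H1)** (every coupling): if the time-resolved two-point identification (H1) holds at every volume
`L ≥ 3` (for the given `β > 0`, `U`, `μ`... quantified inside), then for every `β > 0`, `U`, `μ` there are `B₀`, `L₀`, `Mth` with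
`‖klSelfEnergy L M β U μ 0 klE0 (nScales β + 1) k 0‖ ≤ B₀` for all `L ≥ L₀`, `M ≥ Mth L` and every label `k`. -/
theorem bareFrameBound_of_H1
    (hH1 : ∀ β : ℝ, 0 < β → ∀ (U μ : ℝ) (L : ℕ) [NeZero L], 3 ≤ L → ∀ (x y : TorusSite 2 L), ∀ s ∈ Set.Ioo (0 : ℝ) β,
      Tendsto (fun M : ℕ => gaussExpect ℂ (hubbardCovariance L M β μ 0)
          (positionField L M β 0 0 x s * positionField L M β 1 0 y 0 * grassmannExp (-(hubbardInteraction L M β U)))) atTop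
        (𝓝 ((Real.exp (-(β * U / 4 * (L : ℝ) ^ 2)) : ℂ) *
          (Matrix.gibbsWeight (β - s) (hubbardTorusWith 2 L 1 U (μ + U / 2)) * creation (orb (FermionTorus.ofTorusSite x) 0) *
            (Matrix.gibbsWeight s (hubbardTorusWith 2 L 1 U (μ + U / 2)) * annihilation (orb (FermionTorus.ofTorusSite y) 0))).trace /
          Matrix.partitionFn β (hubbardTorusWith 2 L 1 0 μ)))) :
    ∀ β : ℝ, 0 < β → ∀ U μ : ℝ, ∃ B₀ : ℝ, ∃ L₀ : ℕ, ∃ Mth : ℕ → ℕ,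
      ∀ (L : ℕ) [NeZero L], L₀ ≤ L → ∀ (M : ℕ) [NeZero M], Mth L ≤ M →
        ∀ k : FreqMomentum L M, ‖klSelfEnergy L M β U μ 0 klE0 (nScales β + 1) k 0‖ ≤ B₀ := by
  intro β hβ U μ
  set BH : ℝ := (1 + |U / 2| * β / Real.pi) * (|U / 2| + (1 + |U / 2| * β / Real.pi) * (|U| * (2 + β * |U|))) with hBH
  have hper : ∀ L : ℕ, 3 ≤ L → ∃ M₁ : ℕ, ∀ M : ℕ, M₁ ≤ M → ∀ (hL0 : NeZero L) (k : FreqMomentum L M),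
      ‖klSelfEnergy L M β U μ 0 klE0 (nScales β + 1) k 0‖ ≤ BH + 1 := by
    intro L hL
    haveI : NeZero L := ⟨by omega⟩
    -- (Z1): the word six-point numerator, pointwise limits + eventual sup bound ⇒ `L¹(du)` (k3c5-p3 / k3c4-p2)
    obtain ⟨Sinf, C, hpt, hbd⟩ := sixPoint_pointwise_and_bound (L := L) hβ U μ
    have hz : ∀ z : TorusSite 2 L, IntervalIntegrable (Sinf z) volume 0 β ∧
        Tendsto (fun M : ℕ => ∫ u in (0 : ℝ)..β,
          ‖gaussExpect ℂ (hubbardCovariance L M β μ 0) (grassmannExp (-(hubbardInteraction L M β U)) * sixPointWord L M β 0 1 z u) -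
            Sinf z u‖) atTop (𝓝 0) := fun z =>
      l1_tendsto_of_pointwise_dominated hβ (fun M u => gaussExpect ℂ (hubbardCovariance L M β μ 0)
          (grassmannExp (-(hubbardInteraction L M β U)) * sixPointWord L M β 0 1 z u)) (Sinf z)
        (fun M => continuous_wordSixPoint_up (L := L) (M := M) β U μ z) (hpt z) (hbd.mono fun M hM => hM z)
    -- `h2`: the per-label limits = the Hamiltonian proxy, bounded by `BH`
    have h2 : ∀ (n : ℤ) (p : TorusSite 2 L), ∃ σH : ℂ, ‖σH‖ ≤ BH ∧ ∀ ε : ℝ, 0 < ε → ∃ M₁ : ℕ, ∀ M : ℕ, M₁ ≤ M →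
        ∀ ω : MatsubaraIdx M, matsubaraInt M ω = n → ‖klSelfEnergy L M β U μ 0 klE0 (nScales β + 1) (ω, p) 0 - σH‖ ≤ ε :=
      fun n p => ⟨_, norm_reamputatedProxy_le hL hβ U μ n p, fun ε hε =>
        klSelfEnergy_bare_label_limit_eq_reamputated hL hβ U μ (hH1 β hβ U μ L hL) n p ε hε⟩
    have hev := eventually_norm_klSelfEnergy_bare_le_of_Z1_twoPoint hL hβ U μ Sinf (fun z => (hz z).1) _ (partitionLimit_ne_zero β U μ)
      (tendsto_effPartitionFn_hubbard_eq_partitionFn_div_allU hL hβ μ U) (fun z => (hz z).2) h2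
    obtain ⟨M₁, hM₁⟩ := Filter.eventually_atTop.mp hev
    exact ⟨M₁, fun M hM _ k => hM₁ M hM k⟩
  obtain ⟨Mth, hMth⟩ := exists_thresholdFn hper
  exact ⟨BH + 1, 3, Mth, fun L _ hL M _ hM k => hMth L hL M hM inferInstance k⟩

/-- **GEN-5 CLOSURE: the `klPredsV14` text of `stub_vl_bound` from (H1)** (`Tendsto` form; k3c4-p1's `stub_vl_bound_of_bareFrameBound_V14`). -/
theorem stub_vl_bound_V14_of_H1
    (hH1 : ∀ β : ℝ, 0 < β → ∀ (U μ : ℝ) (L : ℕ) [NeZero L], 3 ≤ L → ∀ (x y : TorusSite 2 L), ∀ s ∈ Set.Ioo (0 : ℝ) β,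
      Tendsto (fun M : ℕ => gaussExpect ℂ (hubbardCovariance L M β μ 0)
          (positionField L M β 0 0 x s * positionField L M β 1 0 y 0 * grassmannExp (-(hubbardInteraction L M β U)))) atTop
        (𝓝 ((Real.exp (-(β * U / 4 * (L : ℝ) ^ 2)) : ℂ) *
          (Matrix.gibbsWeight (β - s) (hubbardTorusWith 2 L 1 U (μ + U / 2)) * creation (orb (FermionTorus.ofTorusSite x) 0) *
            (Matrix.gibbsWeight s (hubbardTorusWith 2 L 1 U (μ + U / 2)) * annihilation (orb (FermionTorus.ofTorusSite y) 0))).trace /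
          Matrix.partitionFn β (hubbardTorusWith 2 L 1 0 μ)))) :
    ∀ (G : GeoConsts) (P : SplitConsts) (Q : EngConsts) (R : RenConsts), G.WF → P.WF → Q.WF → R.WF →
      ∃ c₅ : ℝ, 0 < c₅ ∧ ∀ c : ℝ, 0 < c → c ≤ c₅ → ∃ U₀ : ℝ, 0 < U₀ ∧
        ∀ μ ∈ klWindowC, ∀ U : ℝ, 0 < U → U ≤ U₀ → ∀ β : ℝ, klBetaMin ≤ β → β ≤ Real.exp (c / U ^ 2) →
          ∀ K : TrigPolyC4v, klPredsV14.frameOK R U (nScales β) μ K →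
            ∀ (Lstar : ℕ) (Mstar : ℕ → ℕ), TowerP klPredsV14 G P Q R β U μ K Lstar Mstar →
              ∃ B : ℝ, ∃ L₀ : ℕ, ∃ Mth : ℕ → ℕ, ∀ (L : ℕ) [NeZero L], L₀ ≤ L → ∀ (M : ℕ) [NeZero M], Mth L ≤ M →
                ∀ (k : FreqMomentum L M) (σ : Fin 2), ‖klSelfEnergy L M β U μ K klE0 (nScales β + 1) k σ‖ ≤ B :=
  stub_vl_bound_of_bareFrameBound_V14 (bareFrameBound_of_H1 hH1)

/-- **GEN-5 CLOSURE from the SERIES form of (H1)** (k3c5-p1's `hasSum_twoPointLimitDet_series_time` at spins `(0,0)`, torus-value form). -/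
theorem stub_vl_bound_V14_of_hasSumH1
    (hH1 : ∀ β : ℝ, 0 < β → ∀ (U μ : ℝ) (L : ℕ) [NeZero L], 3 ≤ L → ∀ (x y : TorusSite 2 L), ∀ s ∈ Set.Ioo (0 : ℝ) β,
      HasSum (fun n : ℕ => ((-1 : ℂ) ^ n * ((n ! : ℂ))⁻¹) * ((U : ℂ) ^ n * ∑ xv : Fin n → TorusSite 2 L,
        ∫ τ in Set.Icc (0 : Fin n → ℝ) (fun _ => β),
          (Matrix.of fun i j : Fin (n * 2 + 1) =>
            vertexLimitEntry L β μ ((Fin.append xv ![x, y] : Fin (n + 2) → TorusSite 2 L) (twoPointPlusEnum n 0 i).1)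
              ((Fin.append xv ![x, y] : Fin (n + 2) → TorusSite 2 L) (twoPointMinusEnum n 0 j).1)
              (twoPointPlusEnum n 0 i).2 (twoPointMinusEnum n 0 j).2
              ((Fin.append τ ![s, 0] : Fin (n + 2) → ℝ) (twoPointMinusEnum n 0 j).1 -
                (Fin.append τ ![s, 0] : Fin (n + 2) → ℝ) (twoPointPlusEnum n 0 i).1)).det))
        ((Real.exp (-(β * U / 4 * (L : ℝ) ^ 2)) : ℂ) *
          (Matrix.gibbsWeight (β - s) (hubbardTorusWith 2 L 1 U (μ + U / 2)) * creation (orb (FermionTorus.ofTorusSite x) 0) *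
            (Matrix.gibbsWeight s (hubbardTorusWith 2 L 1 U (μ + U / 2)) * annihilation (orb (FermionTorus.ofTorusSite y) 0))).trace /
          Matrix.partitionFn β (hubbardTorusWith 2 L 1 0 μ))) :
    ∀ (G : GeoConsts) (P : SplitConsts) (Q : EngConsts) (R : RenConsts), G.WF → P.WF → Q.WF → R.WF →
      ∃ c₅ : ℝ, 0 < c₅ ∧ ∀ c : ℝ, 0 < c → c ≤ c₅ → ∃ U₀ : ℝ, 0 < U₀ ∧
        ∀ μ ∈ klWindowC, ∀ U : ℝ, 0 < U → U ≤ U₀ → ∀ β : ℝ, klBetaMin ≤ β → β ≤ Real.exp (c / U ^ 2) →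
          ∀ K : TrigPolyC4v, klPredsV14.frameOK R U (nScales β) μ K →
            ∀ (Lstar : ℕ) (Mstar : ℕ → ℕ), TowerP klPredsV14 G P Q R β U μ K Lstar Mstar →
              ∃ B : ℝ, ∃ L₀ : ℕ, ∃ Mth : ℕ → ℕ, ∀ (L : ℕ) [NeZero L], L₀ ≤ L → ∀ (M : ℕ) [NeZero M], Mth L ≤ M →
                ∀ (k : FreqMomentum L M) (σ : Fin 2), ‖klSelfEnergy L M β U μ K klE0 (nScales β + 1) k σ‖ ≤ B :=
  stub_vl_bound_V14_of_H1 fun β hβ U μ L _ hL x y s hs =>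
    H1_tendsto_of_hasSum hβ μ U x y ⟨hs.1.le, hs.2⟩ (hH1 β hβ U μ L hL x y s hs)

end Summit.HubbardSuperconductivity.HubbardSuperconductivity.Theorems.TwoPointAssembly

end
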